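import Mathlib
import Literature.NumberTheory.Automorphic.HilbertModularFormQExpansion
import Summits.Langlands.Langlands.Theorems.CapacityClassicalityHilbertIntegralOverconvergentIsCongruenceKoecherGlue
import Summits.Langlands.Langlands.Theorems.CapacityClassicalityHilbertIntegralOverconvergentIsCongruenceStubCubeIntegralTranslate
import Summits.Langlands.Langlands.Theorems.CapacityClassicalityHilbertIntegralOverconvergentIsCongruenceStubCubeIntegralIntLinear
import Summits.Langlands.Langlands.Theorems.CapacityClassicalityHilbertIntegralOverconvergentIsCongruenceStubStripIdentity
import Summits.Langlands.Langlands.Theorems.CapacityClassicalityHilbertIntegralOverconvergentIsCongruenceStubEqOfForallSegment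
import Summits.Langlands.Langlands.Theorems.CapacityClassicalityHilbertIntegralOverconvergentIsCongruenceStubTotallyRealEmbeddings
import Summits.Langlands.Langlands.Theorems.CapacityClassicalityHilbertIntegralOverconvergentIsCongruenceStubExistsUnitLtOneAt
import Summits.Langlands.Langlands.Theorems.CapacityClassicalityHilbertIntegralOverconvergentIsCongruenceStubCoeffUnitEquivariance
import Summits.Langlands.Langlands.Theorems.CapacityClassicalityHilbertIntegralOverconvergentIsCongruenceStubKoecherEndgame

/-!
# The Götzky–Koecher principle at the cusp `∞` for the tree's Hilbert modular vocabulary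

Section K of line Sketch-ideate-r1-k1 for the crux `HilbertIntegralOverconvergentIsCongruence`
(stmt-Langlands-8485) — named fact (iv) of the crux NOTES ("Götzky–Koecher"), the second half of idea
`csp-koecher-collapse` (the first half, Serre's congruence subgroup property, is the tree's theorem
`SerreSL2Congruence1970_congruenceSubgroupProperty_holds`).  **Theorem** (Freitag, *Hilbert Modular Forms*,
Ch. I Prop. 4.9, at the standard cusp, in analytic form): let `F` be totally real of degree `≥ 2` and
`f : ℂ^{Hom(F,ℝ)} → ℂ` holomorphic on `ℍ` (`HilbertModular.IsHolomorphicOn`), `𝓞 F`-periodic on `ℍ`, and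
equivariant — `f(εz) = c(ε) f(z)`, `c(ε) ≠ 0` — under the totally positive units `ε` of a finite-index
subgroup `U ≤ (𝓞 F)ˣ`; then the Fourier coefficient `HilbertModular.fourierCoeffAt f ν y` vanishes at
every height `y ≫ 0` for every `ν` of the dual lattice having a negative conjugate
(`koecher_fourierCoeffAt_eq_zero`; restated verbatim with `z ∈ halfSpace F` as the registered stub
`stub_koecher_fourierCoeffAt_eq_zero` of the line's skeleton); consequently `HilbertModular.fourierCoeff f ν = 0` for `ν ≠ 0` not
totally positive (`koecher_fourierCoeff_eq_zero`).  For `f ∈ M_k(Γ)`, `Γ ⊇ Γ₁(𝔫)`, the hypotheses hold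
with `U` = units `≡ 1 (mod 𝔫)` and `c(ε²) = ∏_σ σ(ε)^{k_σ}` (the translations and `diag(ε, ε⁻¹)` lie in `Γ`).

Proof = composition of the eight registered stubs of section K (all landed):
(T2) independence of the height — for a direction `v = realPoint w`, the function
`s ↦ ∫ f(x + s v + iy) e^{…} dx` is holomorphic on a disc and constant on the real diameter (translation
invariance of the cube integral of the periodic integrand, K-A1), hence constant (K-B), so `a_ν` is locally
constant along every line and therefore constant on the convex cone of heights (K-C; directions fill
`ℝ^{Hom(F,ℝ)}` by K-D); (T3) the sup-norm bound (glue); (T4) `c · a_ν(y) = a_{νε⁻¹}(εy)` (K-F, with the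
cube-integral invariance under the integer matrix of multiplication by `ε`, K-A2); (T5) a unit of `U`
contracting at the bad embedding and expanding elsewhere (K-E); (T6) the growth endgame (K-G).
-/

set_option linter.dupNamespace false

noncomputable section

namespace Summit.Langlands.Langlands.Theorems.HilbertIntegralOverconvergentIsCongruence

open MeasureTheory Complex NumberField
open Literature.NumberTheory.Automorphic Literature.NumberTheory.Automorphic.HilbertModular

/-- **(T2) The Fourier coefficient does not depend on the height** (Freitag I.4.1, the part of the
Fourier expansion theorem needed here): for `f` holomorphic and `𝓞 F`-periodic on `ℍ` over a totally
real `F` and `ν` in the dual lattice, `a_ν(y) = a_ν(y')` for all `y, y' ≫ 0`. -/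
theorem fourierCoeffAt_indep (F : Type) [Field F] [NumberField F] [NumberField.IsTotallyReal F]
    (f : Point F → ℂ) (hf : IsHolomorphicOn F f)
    (hper : ∀ (a : 𝓞 F) (z : Point F), (∀ σ, 0 < (z σ).im) → f (fun σ ↦ z σ + ((σ (a : F) : ℝ) : ℂ)) = f z)
    (ν : F) (hν : ∀ a : 𝓞 F, ∃ n : ℤ, Algebra.trace ℚ F (ν * a) = n)
    {y y' : (F →+* ℝ) → ℝ} (hy : ∀ σ, 0 < y σ) (hy' : ∀ σ, 0 < y' σ) :
    fourierCoeffAt f ν y = fourierCoeffAt f ν y' := by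
  obtain ⟨htr, hsurj⟩ := stub_totallyReal_embeddings F
  -- the kernel `H(z) = f(z) e^{-2πi S(νz)}`, holomorphic on the tube
  set H : Point F → ℂ := fun z ↦ f z * cexp (-(2 * Real.pi * I * pairing ν z)) with hHdef
  have hH : DifferentiableOn ℂ H (halfSpace F) := by
    refine hf.mul (Differentiable.differentiableOn ?_)
    simp only [pairing]
    fun_prop
  -- local constancy along every direction, via K-B and K-A1
  have hloc : ∀ y ∈ {y : (F →+* ℝ) → ℝ | ∀ σ, 0 < y σ}, ∀ v : (F →+* ℝ) → ℝ, ∃ δ > 0, ∀ t : ℝ,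
      |t| < δ → y + t • v ∈ {y : (F →+* ℝ) → ℝ | ∀ σ, 0 < y σ} →
      fourierCoeffAt f ν (y + t • v) = fourierCoeffAt f ν y := by
    intro y hy v
    obtain ⟨w, hw⟩ := hsurj v
    obtain ⟨m, hm, hmy⟩ := koe_exists_pos_le y hy
    set V : ℝ := ∑ σ, |v σ| with hV
    have hVσ : ∀ σ, |v σ| ≤ V := fun σ ↦
      Finset.single_le_sum (f := fun σ ↦ |v σ|) (fun _ _ ↦ abs_nonneg _) (Finset.mem_univ σ)
    have hV0 : 0 ≤ V := Finset.sum_nonneg fun _ _ ↦ abs_nonneg _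
    set δ : ℝ := m / (2 * (1 + V)) with hδ
    have hδpos : 0 < δ := by positivity
    have hδV : δ * V ≤ m / 2 := by
      rw [hδ, div_mul_eq_mul_div, div_le_div_iff₀ (by positivity) (by positivity)]
      nlinarith
    -- the direction in `ℂ^τ` and the base points
    set u : Point F := fun σ ↦ ((v σ : ℝ) : ℂ) with hu
    set p : Coord F → Point F := fun x ↦ cubePoint x y with hp
    have hmem : ∀ x ∈ Set.Icc (0 : Coord F) 1, ∀ s : ℂ, ‖s‖ ≤ δ → p x + s • u ∈ halfSpace F := by
      intro x _ s hs σ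
      show 0 < ((p x + s • u) σ).im
      simp only [Pi.add_apply, Pi.smul_apply, smul_eq_mul, hp, hu, Complex.add_im, koe_cubePoint_im,
        Complex.mul_im, Complex.ofReal_re, Complex.ofReal_im, mul_zero]
      have h1 : |s.im * v σ| ≤ δ * V := by
        rw [abs_mul]
        exact mul_le_mul ((Complex.abs_im_le_norm s).trans hs) (hVσ σ) (abs_nonneg _) hδpos.le
      have h2 : -(δ * V) ≤ s.im * v σ := by linarith [neg_abs_le (s.im * v σ)]
      linarith [hmy σ]
    have hreal : ∀ s : ℝ, |s| < δ →
        ∫ x in Set.Icc (0 : Coord F) 1, H (p x + (s : ℂ) • u) = ∫ x in Set.Icc (0 : Coord F) 1, H (p x) := by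
      intro s _
      have hshift : ∀ x, p x + (s : ℂ) • u = cubePoint (x + s • w) y := by
        intro x
        rw [koe_cubePoint_add_smul]
        funext σ
        simp only [hp, hu, Pi.add_apply, Pi.smul_apply, smul_eq_mul, ← hw, realPoint]
      simp_rw [hshift]
      exact stub_cubeIntegral_translate (fun x ↦ H (cubePoint x y))
        (koe_integrand_periodic htr f hper hν hy) (s • w)
    have key := stub_stripIdentity H (halfSpace F) isOpen_halfSpace hH p (koe_continuous_cubePoint y) u δ
      hδpos hmem hreal
    refine ⟨δ, hδpos, fun t ht _ ↦ ?_⟩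
    have hnorm : ‖((t : ℂ) * I)‖ < δ := by simpa using ht
    have k := key ((t : ℂ) * I) hnorm
    have hshift : ∀ x, p x + ((t : ℂ) * I) • u = cubePoint x (y + t • v) := by
      intro x
      rw [koe_cubePoint_height_add]
      funext σ
      simp only [hp, hu, Pi.add_apply, Pi.smul_apply, smul_eq_mul]
    simp_rw [hshift] at k
    exact k
  exact stub_eq_of_forall_segment {y | ∀ σ, 0 < y σ} koe_convex_heights (fourierCoeffAt f ν) hloc hy hy'

/-- **The Götzky–Koecher principle at the cusp `∞` (analytic form, Freitag I.4.9).**  `F` totally real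
of degree `≥ 2`; `f` holomorphic on `ℍ`, `𝓞 F`-periodic on `ℍ`, and `f(εz) = c(ε) f(z)` with
`c(ε) ≠ 0` for the totally positive units `ε` of a finite-index subgroup `U ≤ (𝓞 F)ˣ`; `ν` in the dual
lattice (`Tr(ν 𝓞_F) ⊆ ℤ`) with a negative conjugate `φ(ν) < 0`.  Then the Fourier coefficient
`a_ν(y) = HilbertModular.fourierCoeffAt f ν y` vanishes at every height `y ≫ 0`. -/
theorem koecher_fourierCoeffAt_eq_zero (F : Type) [Field F] [NumberField F] [NumberField.IsTotallyReal F]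
    (hd : 1 < Module.finrank ℚ F) (f : Point F → ℂ) (hf : IsHolomorphicOn F f)
    (hper : ∀ (a : 𝓞 F) (z : Point F), (∀ σ, 0 < (z σ).im) → f (fun σ ↦ z σ + ((σ (a : F) : ℝ) : ℂ)) = f z)
    (U : Subgroup (𝓞 F)ˣ) (hU : U.FiniteIndex) (c : (𝓞 F)ˣ → ℂ) (hc : ∀ ε ∈ U, c ε ≠ 0)
    (hmod : ∀ ε ∈ U, (∀ σ : F →+* ℝ, 0 < σ ((ε : 𝓞 F) : F)) → ∀ z : Point F, (∀ σ, 0 < (z σ).im) →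
      f (fun σ ↦ ((σ ((ε : 𝓞 F) : F) : ℝ) : ℂ) * z σ) = c ε * f z)
    (ν : F) (hν : ∀ a : 𝓞 F, ∃ n : ℤ, Algebra.trace ℚ F (ν * a) = n) (φ : F →+* ℝ) (hφν : φ ν < 0)
    (y : (F →+* ℝ) → ℝ) (hy : ∀ σ, 0 < y σ) :
    fourierCoeffAt f ν y = 0 := by
  -- the dual lattice, stable under units
  set D : Set F := {ν | ∀ a : 𝓞 F, ∃ n : ℤ, Algebra.trace ℚ F (ν * a) = n} with hDdef
  have hνD : ν ∈ D := hν
  have hDunit : ∀ ν ∈ D, ∀ u : (𝓞 F)ˣ, ν * ((u : 𝓞 F) : F) ∈ D := by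
    intro ν hν u a
    obtain ⟨n, hn⟩ := hν ((u : 𝓞 F) * a)
    exact ⟨n, by simpa [mul_assoc] using hn⟩
  -- (T2) independence of the height
  have hindep : ∀ ν ∈ D, ∀ y y' : (F →+* ℝ) → ℝ, (∀ σ, 0 < y σ) → (∀ σ, 0 < y' σ) →
      fourierCoeffAt f ν y = fourierCoeffAt f ν y' :=
    fun ν hν y y' hy hy' ↦ fourierCoeffAt_indep F f hf hper ν hν hy hy'
  -- (T3) the sup-norm bound, uniform in `ν`
  set M : ((F →+* ℝ) → ℝ) → ℝ := fun y ↦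
    sSup ((fun x : Coord F ↦ ‖f (cubePoint x y)‖) '' Set.Icc 0 1) with hM
  have hbound : ∀ ν ∈ D, ∀ y : (F →+* ℝ) → ℝ, (∀ σ, 0 < y σ) →
      ‖fourierCoeffAt f ν y‖ ≤ M y * Real.exp (2 * Real.pi * ∑ σ : F →+* ℝ, σ ν * y σ) :=
    fun ν _ y hy ↦ koe_norm_fourierCoeffAt_le f hf.continuousOn ν hy
  -- (T5) the unit
  obtain ⟨ε, hεU, hεpos, hεφ, hεψ⟩ :=
    stub_exists_unit_lt_one_at U hU φ (koe_exists_realEmbedding_ne F hd φ)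
  -- (T4) equivariance for `ε`, via K-A2 for the integer matrix of multiplication by `ε`
  have hinv := fun (g : Coord F → ℂ)
      (hg : ∀ (m : Module.Free.ChooseBasisIndex ℤ (𝓞 F) → ℤ) (x : Coord F),
        g (x + fun i ↦ (m i : ℝ)) = g x) ↦
    stub_cubeIntegral_intLinear g hg (Algebra.leftMulMatrix (RingOfIntegers.basis F) (ε : 𝓞 F))
      (Algebra.leftMulMatrix (RingOfIntegers.basis F) ((ε⁻¹ : (𝓞 F)ˣ) : 𝓞 F))
      (by rw [← map_mul, Units.mul_inv, map_one])
  have hequiv : ∀ ν ∈ D, ∀ y : (F →+* ℝ) → ℝ, (∀ σ, 0 < y σ) →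
      c ε * fourierCoeffAt f ν y =
        fourierCoeffAt f (ν * ((ε⁻¹ : (𝓞 F)ˣ) : 𝓞 F)) (fun σ ↦ σ ((ε : 𝓞 F) : F) * y σ) :=
    fun ν hν y hy ↦ stub_coeff_unit_equivariance F f hper ε hεpos (c ε) (hmod ε hεU hεpos) hinv ν hν y hy
  -- (T6) the endgame
  exact stub_koecher_endgame F D hDunit (fourierCoeffAt f) hindep M hbound ε hεpos φ hεφ hεψ (c ε)
    (hc ε hεU) hequiv ν hνD hφν y hy

/-- **Registered stub `stub_koecher_fourierCoeffAt_eq_zero`** (stub L7 of line Sketch-ideate-r1-k1 of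
the crux `HilbertIntegralOverconvergentIsCongruence`, stmt-Langlands-8485): the Götzky–Koecher principle
at the cusp `∞` (Freitag I.4.9) exactly as registered by the skeleton, i.e.
`koecher_fourierCoeffAt_eq_zero` with the periodicity and unit-equivariance hypotheses phrased through
membership in `HilbertModular.halfSpace F` (definitionally `∀ σ, 0 < Im z_σ`, `mem_halfSpace_iff`). -/
theorem stub_koecher_fourierCoeffAt_eq_zero (F : Type) [Field F] [NumberField F]
    [NumberField.IsTotallyReal F]
    (hd : 1 < Module.finrank ℚ F) (f : Point F → ℂ) (hf : IsHolomorphicOn F f)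
    (hper : ∀ (a : 𝓞 F) (z : Point F), z ∈ halfSpace F → f (fun σ ↦ z σ + ((σ (a : F) : ℝ) : ℂ)) = f z)
    (U : Subgroup (𝓞 F)ˣ) (hU : U.FiniteIndex) (c : (𝓞 F)ˣ → ℂ) (hc : ∀ ε ∈ U, c ε ≠ 0)
    (hmod : ∀ ε ∈ U, (∀ σ : F →+* ℝ, 0 < σ ((ε : 𝓞 F) : F)) → ∀ z ∈ halfSpace F,
      f (fun σ ↦ ((σ ((ε : 𝓞 F) : F) : ℝ) : ℂ) * z σ) = c ε * f z)
    (ν : F) (hν : ∀ a : 𝓞 F, ∃ n : ℤ, Algebra.trace ℚ F (ν * a) = n) (φ : F →+* ℝ) (hφν : φ ν < 0)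
    (y : (F →+* ℝ) → ℝ) (hy : ∀ σ, 0 < y σ) :
    fourierCoeffAt f ν y = 0 :=
  koecher_fourierCoeffAt_eq_zero F hd f hf (fun a z hz ↦ hper a z (mem_halfSpace_iff.2 hz)) U hU c hc
    (fun ε hε hpos z hz ↦ hmod ε hε hpos z (mem_halfSpace_iff.2 hz)) ν hν φ hφν y hy

/-- **Götzky–Koecher, `q`-expansion form**: under the same hypotheses, the Fourier coefficient at the
standard height `HilbertModular.fourierCoeff f ν` vanishes for every non-zero `ν` of the dual lattice
which is not totally positive (a non-zero field element with all conjugates `≥ 0` has all conjugates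
`> 0`, so some conjugate is negative). [cite: Freitag1990, Ch. I Prop. 4.9] -/
theorem koecher_fourierCoeff_eq_zero (F : Type) [Field F] [NumberField F] [NumberField.IsTotallyReal F]
    (hd : 1 < Module.finrank ℚ F) (f : Point F → ℂ) (hf : IsHolomorphicOn F f)
    (hper : ∀ (a : 𝓞 F) (z : Point F), (∀ σ, 0 < (z σ).im) → f (fun σ ↦ z σ + ((σ (a : F) : ℝ) : ℂ)) = f z)
    (U : Subgroup (𝓞 F)ˣ) (hU : U.FiniteIndex) (c : (𝓞 F)ˣ → ℂ) (hc : ∀ ε ∈ U, c ε ≠ 0)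
    (hmod : ∀ ε ∈ U, (∀ σ : F →+* ℝ, 0 < σ ((ε : 𝓞 F) : F)) → ∀ z : Point F, (∀ σ, 0 < (z σ).im) →
      f (fun σ ↦ ((σ ((ε : 𝓞 F) : F) : ℝ) : ℂ) * z σ) = c ε * f z)
    (ν : F) (hν : ∀ a : 𝓞 F, ∃ n : ℤ, Algebra.trace ℚ F (ν * a) = n) (hν0 : ν ≠ 0)
    (hνpos : ¬ ∀ σ : F →+* ℝ, 0 < σ ν) :
    fourierCoeff f ν = 0 := by
  obtain ⟨φ, hφ⟩ := not_forall.1 hνpos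
  have hφν : φ ν < 0 := by
    rcases lt_trichotomy (φ ν) 0 with h | h | h
    · exact h
    · exact absurd ((map_eq_zero φ).1 h) hν0
    · exact absurd h hφ
  exact koecher_fourierCoeffAt_eq_zero F hd f hf hper U hU c hc hmod ν hν φ hφν (fun _ ↦ 1)
    fun _ ↦ one_pos

end Summit.Langlands.Langlands.Theorems.HilbertIntegralOverconvergentIsCongruence
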